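import Mathlib.Analysis.SpecialFunctions.BinaryEntropy
import Mathlib.Analysis.SpecialFunctions.Log.Basic
import Mathlib.Analysis.SpecialFunctions.Exp
import HarnessLib

/-!
# The first-power rate has vanishing excess — stub `stub_rateVanishes` of line `registered`
(crux `PerfectAmortisation`, stmt-MatrixMultiplication-10893, route ShapeSubmodularity / EPRFaces)

The packing stubs of the line bound the rectangular exponent by
`ω(1,1,k) ≤ f(k,q) := (k+2) (log (q+2) − h(1/(k+2))) / log q` for all `q ≥ 2`, `k ≥ 1`
(`h = Real.binEntropy`, natural logarithms).  This file proves the last, purely real-analytic step: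
for every `ε > 0` some admissible `(q, k)` has `f(k,q) < k + 1 + ε`.

Proof: take `q := k + 2` and write `x := k + 2 ≥ 3`.  Dropping the (non-negative) second summand
of `Real.binEntropy` gives `h(1/x) ≥ (log x)/x`, and `log (x+2) = log x + log ((x+2)/x) ≤
log x + 2/x` (`Real.log_le_sub_one_of_pos`).  Hence the numerator is at most
`x log x + 2 − log x = (k+1) log x + 2`, and after dividing by `log q = log x > 0` the claim
reduces to `2 < ε log x`, i.e. `x > exp (2/ε)`, which holds for `k := max 1 ⌈exp (2/ε)⌉₊`.
-/

set_option linter.dupNamespace false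
-- (single-conjunct summit: the namespace repeats `MatrixMultiplication`)

namespace Summit.MatrixMultiplication.MatrixMultiplication.Theorems.PerfectAmortisation

/-- First-summand lower bound for the binary entropy at a reciprocal: for `1 < x`,
`log x / x ≤ h(1/x)`, because `h(1/x) = (1/x) log x + (1 - 1/x) log (1 - 1/x)⁻¹` and the second
summand is non-negative (`0 < 1 - 1/x ≤ 1`, so `1 ≤ (1 - 1/x)⁻¹`). [folklore] -/
theorem log_div_self_le_binEntropy_one_div {x : ℝ} (hx : 1 < x) :
    Real.log x / x ≤ Real.binEntropy (1 / x) := by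
  have hx0 : 0 < x := one_pos.trans hx
  have hlt : 1 / x < 1 := (div_lt_one hx0).2 hx
  have hpos : 0 < 1 / x := by positivity
  have h1 : 1 / x * Real.log (1 / x)⁻¹ = Real.log x / x := by
    rw [one_div, inv_inv, div_eq_inv_mul]
  have h2 : 0 ≤ (1 - 1 / x) * Real.log (1 - 1 / x)⁻¹ := by
    refine mul_nonneg (by linarith) (Real.log_nonneg ?_)
    rw [one_le_inv₀ (by linarith)]
    linarith
  unfold Real.binEntropy
  linarith

/-- Logarithmic increment bound: for `0 < x`, `log (x + 2) ≤ log x + 2 / x`, from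
`log ((x+2)/x) ≤ (x+2)/x - 1 = 2/x` (`Real.log_le_sub_one_of_pos`, `Real.log_div`). [folklore] -/
theorem log_add_two_le {x : ℝ} (hx : 0 < x) :
    Real.log (x + 2) ≤ Real.log x + 2 / x := by
  have h : Real.log ((x + 2) / x) ≤ (x + 2) / x - 1 :=
    Real.log_le_sub_one_of_pos (by positivity)
  rw [Real.log_div (by positivity) hx.ne'] at h
  have h' : (x + 2) / x - 1 = 2 / x := by
    field_simp
    ring
  linarith

/-- **Stub D (the rate: the first-power value has vanishing excess).**  For every `ε > 0` some
`q ≥ 2`, `k ≥ 1` satisfy `f(k,q) = (k+2) (log (q+2) − h(1/(k+2))) / log q < k + 1 + ε`.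
Witness: `q = k + 2`, `k = max 1 ⌈exp (2/ε)⌉₊`; with `x = k + 2`,
`(k+2)(log (x+2) − h(1/x)) ≤ x log x + 2 − log x = (k+1) log x + 2 < (k+1+ε) log x`
since `log x > 2/ε`. [folklore] -/
theorem stub_rateVanishes :
    ∀ ε : ℝ, 0 < ε → ∃ q k : ℕ, 2 ≤ q ∧ 1 ≤ k ∧
      ((k : ℝ) + 2) * (Real.log ((q : ℝ) + 2) - Real.binEntropy (1 / ((k : ℝ) + 2))) /
          Real.log (q : ℝ) < (k : ℝ) + 1 + ε := by
  intro ε hε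
  -- choose `k ≥ 1` with `exp (2/ε) < k + 2`
  obtain ⟨k, hk1, hkexp⟩ : ∃ k : ℕ, 1 ≤ k ∧ Real.exp (2 / ε) < (k : ℝ) + 2 := by
    refine ⟨max 1 ⌈Real.exp (2 / ε)⌉₊, le_max_left _ _, ?_⟩
    have h1 : Real.exp (2 / ε) ≤ ⌈Real.exp (2 / ε)⌉₊ := Nat.le_ceil _
    have h2 : ((⌈Real.exp (2 / ε)⌉₊ : ℕ) : ℝ) ≤ ((max 1 ⌈Real.exp (2 / ε)⌉₊ : ℕ) : ℝ) := by
      exact_mod_cast le_max_right _ _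
    linarith
  refine ⟨k + 2, k, by omega, hk1, ?_⟩
  have hcast : ((k + 2 : ℕ) : ℝ) = (k : ℝ) + 2 := by push_cast; ring
  rw [hcast]
  have hk1' : (1 : ℝ) ≤ k := by exact_mod_cast hk1
  have hx0 : (0 : ℝ) < (k : ℝ) + 2 := by positivity
  have hx1 : (1 : ℝ) < (k : ℝ) + 2 := by linarith
  have hlogpos : 0 < Real.log ((k : ℝ) + 2) := Real.log_pos hx1
  -- `2 < ε * log (k+2)` from the choice of `k`
  have hlogbig : 2 / ε < Real.log ((k : ℝ) + 2) := (Real.lt_log_iff_exp_lt hx0).2 hkexp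
  have hεlog : 2 < Real.log ((k : ℝ) + 2) * ε := (div_lt_iff₀ hε).1 hlogbig
  -- entropy lower bound and logarithmic increment bound, multiplied through by `k + 2`
  have hH : Real.log ((k : ℝ) + 2) ≤
      ((k : ℝ) + 2) * Real.binEntropy (1 / ((k : ℝ) + 2)) := by
    have h := mul_le_mul_of_nonneg_left (log_div_self_le_binEntropy_one_div hx1) hx0.le
    calc Real.log ((k : ℝ) + 2) = ((k : ℝ) + 2) * (Real.log ((k : ℝ) + 2) / ((k : ℝ) + 2)) := by
          field_simp
      _ ≤ ((k : ℝ) + 2) * Real.binEntropy (1 / ((k : ℝ) + 2)) := h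
  have hL : ((k : ℝ) + 2) * Real.log ((k : ℝ) + 2 + 2) ≤
      ((k : ℝ) + 2) * Real.log ((k : ℝ) + 2) + 2 := by
    have h := mul_le_mul_of_nonneg_left (log_add_two_le hx0) hx0.le
    calc ((k : ℝ) + 2) * Real.log ((k : ℝ) + 2 + 2)
          ≤ ((k : ℝ) + 2) * (Real.log ((k : ℝ) + 2) + 2 / ((k : ℝ) + 2)) := h
      _ = ((k : ℝ) + 2) * Real.log ((k : ℝ) + 2) + 2 := by
          field_simp
  rw [div_lt_iff₀ hlogpos]
  linarith
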